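import Summits.BirchSwinnertonDyer.Rank1Residual.F1Sign2.BranchCongruenceModTwoAtTwo
import Summits.BirchSwinnertonDyer.Rank1Residual.F1Sign2.RhombicSymbolCongruenceHolds
import Literature.NumberTheory.EllipticCurves.PAdicLFunctionMinusIntegralityAtTwoProofs
import Literature.NumberTheory.EllipticCurves.PAdicLFunctionIntegralityProofs
import Literature.NumberTheory.EllipticCurves.PAdicLFunctionProofs
import Literature.NumberTheory.EllipticCurves.PAdicLFunctionIntegralityAtTwoAutoProofs
import Literature.NumberTheory.EllipticCurves.PAdicLFunctionIntegralityAtTwoProofs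
import Literature.NumberTheory.EllipticCurves.PAdicLFunctionInterpolationProofs
import Literature.NumberTheory.EllipticCurves.PAdicLFunctionDistributionProofs
import Literature.NumberTheory.EllipticCurves.PAdicLFunctionDistributionHoldsProofs
import Literature.NumberTheory.EllipticCurves.PAdicLFunctionMinusDistributionProofs
import Literature.NumberTheory.EllipticCurves.PAdicLFunctionMinusIntegralityProofs
import Literature.NumberTheory.EllipticCurves.PAdicMeasureTransformBranches
import Literature.NumberTheory.EllipticCurves.PAdicBSDProofs
import Literature.NumberTheory.EllipticCurves.PAdicLFunctionInterpolationHoldsProofs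
import Literature.NumberTheory.EllipticCurves.PAdicLFunctionNeZeroProofs
import HarnessLib

/-!
# Proofs for `F1Sign2/BranchCongruenceModTwoAtTwo.lean` (p543248) — cell `bsd-f1-sign2`, seat `-imc` g1

TURNKEY filing by the typer seat `bsd-f1-sign2-ty` (INBOX 2026-08-27T15:43/15:45Z, T-imc-3): the planner-of-record's
kernel-checked file `HOME/MEMO-imc-data/F1Sign2ProofsB.lean` sha16 6c43c7afdd8efbe8 (rc 0, 0 sorry, farm-checked against
p543248 + p544233), re-filed VERBATIM (one bib key spelling fixed). PARTITION: none moved.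

PROOF-ONLY module over the TREE statements (no `def`, no restatement; companion of
`RhombicSymbolCongruenceHolds.lean`, p544233). It proves

* **A♮L at good ordinary odd level** — `branchCongruenceModTwo_of_rhombic`: for a rational newform `f`
  of odd level `N` with RHOMBIC period lattice, `a₂ = a₂(f)`, and a root `α` of `X² − a₂X + 2` with
  `‖α‖ ≤ 1`, `‖α⁻¹‖ ≤ 1` (the unit root; the hypotheses force `a₂` odd), the even branch `L₂(f,α,ω⁰)`
  and the odd branch `L₂⁻(f,α,ω¹)` lie in `Λ₂` and are congruent mod `2Λ₂` (`BranchCongruenceModTwo f α`);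
* `rhombicBranchCongruence_goodOrdinary` — clause 1 of `RhombicBranchCongruence`;
* `ordinaryBranchCongruenceAtTwo_of_rhombicOfNegDisc : RhombicOfNegDisc → OrdinaryBranchCongruenceAtTwo`;
* the two-input reductions of the tree conjecture A (`OddEvenCongruenceAtTwo`, p538414) and crux K3:
  `oddEvenCongruenceAtTwo_of_rhombicOfNegDisc_of_muZero : RhombicOfNegDisc → AnalyticMuZeroAtTwo →
  OddEvenCongruenceAtTwo`, `oddBranchCertificateSupply_of_rhombicOfNegDisc_of_muZero`;
* `supersingularLayerCongruenceAtTwo_of_rhombicOfNegDisc : RhombicOfNegDisc → SupersingularLayerCongruenceAtTwo`.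

Method: both Riemann sums at `2` are `2·Σ_{s<2ⁿ} μ^±(5ˢ mod 2ⁿ⁺²) C(s,k)` (`padicLRiemannSum_two`,
`finsum_weighted_two_of_odd`); A♮sym (`rhombicSymbolCongruence_holds`) makes `μ⁺ − μ⁻` an integral term
plus the offset `[1/2]⁺(α^{−(n+2)} − α^{−(n+3)})`, which sums to `α^{−(n+3)}((α−1)[1/2]⁺)·C(2ⁿ,k+1)`
(hockey stick) of norm `≤ 2 · 2⁻¹` (Kummer, `Nat.Prime.dvd_choose_pow`); so `‖[Tᵏ](L⁺−L⁻)‖₂ ≤ 2⁻¹` for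
all `k`, and integrality of `L⁺` (`norm_padicLCoeff_two_le_one_auto`, no `E[2]` hypothesis), of `L⁻`
(`norm_padicLMinusBranchCoeff_two_le_one`) and of `(L⁺−L⁻)/2` plus `iwasawaToPowerSeries_injective`
give `G − D ∈ 2Λ₂`.
Remaining OPEN tree inputs (not touched here): `AnalyticMuZeroAtTwo` (K2μ, the crux), `RhombicOfNegDisc`
(lattice shape, support), clause 2 of `RhombicBranchCongruence` / `MultBranchCongruenceAtTwo`,
`AnalyticMuZeroMultAtTwo`, `MultPackageIsPlusBranch`.
Sources: [cite: MazurTateTeitelbaum1986Invent, §I.10–I.13] (MSD measures, branches),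
[cite: CremonaAlgorithms1997, §2.8–2.10] (lattice types). Axioms: propext, Classical.choice, Quot.sound.
-/

set_option autoImplicit false

noncomputable section

open scoped Classical MatrixGroups ModularForm
open CongruenceSubgroup Polynomial
open Literature.NumberTheory.EllipticCurves Literature.NumberTheory.EllipticCurves.ModularForms
open Literature.NumberTheory.EllipticCurves.Greenberg1999
open Literature.NumberTheory.EllipticCurves.Rank1Residual
open Summit.BirchSwinnertonDyer.Rank1Residual.X1.MuLambda
open Summit.BirchSwinnertonDyer.Rank1Residual.X5

namespace Summit.BirchSwinnertonDyer.Rank1Residual.F1Sign2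

/-! ## §B. A♮L — the mod-`2Λ₂` congruence of the even and odd `2`-adic branches (good ordinary, odd `N`)

The limit passage from A♮sym: by the `Δ = {±1}`-doubling both Riemann sums at `2` are
`2 · Σ_{s mod 2ⁿ} μ^±(5ˢ + 2ⁿ⁺²ℤ₂) C(s,k)`; by `rhombicSymbolCongruence`,
`2(μ⁺ − μ⁻)(b + 2ⁿ⁺²ℤ₂) = (2ℤ₂-integral) + 2[1/2]⁺ α^{−(n+3)}(α − 1)` for every odd `b`, and the
offset sums to `2[1/2]⁺α^{−(n+3)}(α − 1) · C(2ⁿ, k+1)` (hockey stick), of norm `≤ ‖C(2ⁿ,k+1)‖₂ ≤ 2⁻¹`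
as soon as `0 < k + 1 < 2ⁿ`. Hence `‖[Tᵏ](L⁺ − L⁻)‖₂ ≤ 2⁻¹` for every `k`, i.e. `L⁺ − L⁻ ∈ 2Λ₂`. -/

section BranchAlgebra

open Filter Topology

/-- `‖2‖₂ = 2⁻¹` (helper). [folklore] -/
private theorem norm_two_two' : ‖(2 : ℚ_[2])‖ = (2 : ℝ)⁻¹ := by
  have h := Padic.norm_p (p := 2)
  simpa using h

/-- `‖m‖₂ ≤ 1` for a natural number `m` (helper). [folklore] -/
private theorem norm_natCast_le_one' (m : ℕ) : ‖((m : ℕ) : ℚ_[2])‖ ≤ 1 := by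
  have h := Padic.norm_int_le_one (p := 2) (m : ℤ)
  rwa [Int.cast_natCast] at h

/-- Hockey stick: `Σ_{j < M} C(j, k) = C(M, k + 1)`. [folklore] -/
theorem sum_range_choose_eq_choose_succ (M k : ℕ) :
    ∑ j ∈ Finset.range M, j.choose k = M.choose (k + 1) := by
  induction M with
  | zero => simp
  | succ M ih => rw [Finset.sum_range_succ, ih, Nat.choose_succ_succ, add_comm]

/-- `Σ_{s : ℤ/M} F(s.val) = Σ_{j < M} F(j)`. [folklore] -/
theorem sum_zmod_val_eq_sum_range {A : Type*} [AddCommMonoid A] (M : ℕ) [NeZero M] (F : ℕ → A) :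
    ∑ s : ZMod M, F s.val = ∑ j ∈ Finset.range M, F j := by
  obtain ⟨m, rfl⟩ : ∃ m, M = m + 1 := ⟨M - 1, (Nat.succ_pred_eq_of_pos (NeZero.pos M)).symm⟩
  exact Fin.sum_univ_eq_sum_range F (m + 1)

/-- `‖C(2ⁿ, j)‖₂ ≤ 2⁻¹` for `0 < j < 2ⁿ` (Kummer; Mathlib `Nat.Prime.dvd_choose_pow`). [folklore] -/
theorem norm_choose_two_pow_le_half {n j : ℕ} (hj : j ≠ 0) (hjn : j < 2 ^ n) :
    ‖(((2 ^ n).choose j : ℕ) : ℚ_[2])‖ ≤ 2⁻¹ := by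
  obtain ⟨q, hq⟩ := Nat.prime_two.dvd_choose_pow hj hjn.ne
  rw [hq, Nat.cast_mul, norm_mul, Nat.cast_ofNat, norm_two_two']
  calc (2 : ℝ)⁻¹ * ‖((q : ℕ) : ℚ_[2])‖ ≤ 2⁻¹ * 1 := by
        gcongr; exact norm_natCast_le_one' q
    _ = 2⁻¹ := mul_one _

variable {N : ℕ} [NeZero N]

omit [NeZero N] in
/-- The MSD measures at level `m + 2` over `p = 2`, unfolded. -/
theorem msdMeasure_two_level (f : CuspForm (Gamma0 N) 2) (α : ℚ_[2]) (m : ℕ)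
    (a : ZMod (2 ^ (m + 2))) :
    msdMeasure f α (m + 2) a =
      α⁻¹ ^ (m + 2) * ((ratPlusSymbol f ((a.val : ℚ) / (2 : ℚ) ^ (m + 2)) : ℚ) : ℚ_[2]) -
        α⁻¹ ^ (m + 3) * ((ratPlusSymbol f ((a.val : ℚ) / (2 : ℚ) ^ (m + 1)) : ℚ) : ℚ_[2]) := by
  simp only [msdMeasure]
  push_cast
  ring_nf

omit [NeZero N] in
/-- The minus MSD measure at `2` on the coset `a + 2^m ℤ₂` in level coordinates (twin of
`msdMeasure_two_level`). [cite: MazurTateTeitelbaum1986Invent, §I.10 (10.1)] -/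
theorem msdMinusMeasure_two_level (f : CuspForm (Gamma0 N) 2) (α : ℚ_[2]) (m : ℕ)
    (a : ZMod (2 ^ (m + 2))) :
    msdMinusMeasure f α (m + 2) a =
      α⁻¹ ^ (m + 2) * ((ratMinusSymbol f ((a.val : ℚ) / (2 : ℚ) ^ (m + 2)) : ℚ) : ℚ_[2]) -
        α⁻¹ ^ (m + 3) * ((ratMinusSymbol f ((a.val : ℚ) / (2 : ℚ) ^ (m + 1)) : ℚ) : ℚ_[2]) := by
  simp only [msdMinusMeasure]
  push_cast
  ring_nf

/-- The values of `5ˢ mod 2ᵐ⁺²` are odd. -/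
theorem odd_val_cyclotomicGenerator_pow (m t : ℕ) :
    Odd (((cyclotomicGenerator 2 : ZMod (2 ^ (m + 2))) ^ t).val) := by
  rw [cyclotomicGenerator_two, ← Nat.cast_pow, ZMod.val_natCast, Nat.odd_iff,
    Nat.mod_mod_of_dvd _ (dvd_pow_self 2 (by omega : m + 2 ≠ 0))]
  exact Nat.odd_iff.mp (Odd.pow (by decide))

/-- **KEY FINITE-LEVEL ESTIMATE.** Under the symbol congruence `PlusMinusSymbolCongruenceAtTwo f`
and `‖(α − 1)[1/2]⁺‖₂ ≤ 2`, `‖α⁻¹‖ ≤ 1`: for `n ≥ k + 1`,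
`‖RS⁺(k, n) − RS⁻_{ω¹}(k, n)‖₂ ≤ 2⁻¹`. -/
theorem norm_riemannSum_sub_minus_le_half (f : CuspForm (Gamma0 N) 2) {α : ℚ_[2]} (hα0 : α ≠ 0)
    (hα : ‖α⁻¹‖ ≤ 1) (hPM : PlusMinusSymbolCongruenceAtTwo f)
    (hc : ‖(α - 1) * ((ratPlusSymbol f (1 / 2) : ℚ) : ℚ_[2])‖ ≤ 2) {k n : ℕ} (hn : k + 1 ≤ n) :
    ‖padicLRiemannSum f α k n - padicLMinusBranchRiemannSum f α 1 k n‖ ≤ 2⁻¹ := by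
  classical
  rw [padicLRiemannSum_two]
  unfold padicLMinusBranchRiemannSum
  rw [finsum_weighted_two_of_odd (μ := msdMinusMeasure f α) (msdMinusMeasure_neg f α) odd_one k n]
  set c : ℚ_[2] := ((ratPlusSymbol f (1 / 2) : ℚ) : ℚ_[2]) with hcdef
  have hαi : ∀ j : ℕ, ‖α⁻¹ ^ j‖ ≤ 1 := fun j ↦ by
    rw [norm_pow]; exact pow_le_one₀ (norm_nonneg _) hα
  -- per-cell identity from the symbol congruence
  have hμ : ∀ s : ZMod (2 ^ n), ∃ k₁ k₂ : ℤ,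
      msdMeasure f α (n + 2) ((cyclotomicGenerator 2 : ZMod (2 ^ (n + 2))) ^ s.val) -
        msdMinusMeasure f α (n + 2) ((cyclotomicGenerator 2 : ZMod (2 ^ (n + 2))) ^ s.val) =
      α⁻¹ ^ (n + 2) * (c + k₁) - α⁻¹ ^ (n + 3) * (c + k₂) := by
    intro s
    set b : ZMod (2 ^ (n + 2)) := (cyclotomicGenerator 2 : ZMod (2 ^ (n + 2))) ^ s.val with hb
    have hbo : Odd ((b.val : ℕ) : ℤ) := (odd_val_cyclotomicGenerator_pow n s.val).natCast
    obtain ⟨k₁, hk₁⟩ := hPM (b.val : ℤ) (n + 2) hbo (by omega)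
    obtain ⟨k₂, hk₂⟩ := hPM (b.val : ℤ) (n + 1) hbo (by omega)
    push_cast at hk₁ hk₂
    have hk₁' := congrArg (fun q : ℚ ↦ (q : ℚ_[2])) hk₁
    have hk₂' := congrArg (fun q : ℚ ↦ (q : ℚ_[2])) hk₂
    push_cast at hk₁' hk₂'
    refine ⟨k₁, k₂, ?_⟩
    rw [msdMeasure_two_level f α n b, msdMinusMeasure_two_level f α n b, hcdef]
    linear_combination α⁻¹ ^ (n + 2) * hk₁' - α⁻¹ ^ (n + 3) * hk₂'
  choose k₁ k₂ hk using hμ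
  -- regroup the difference of the two sums
  have hsum : ∑ s : ZMod (2 ^ n),
      msdMeasure f α (n + 2) ((cyclotomicGenerator 2 : ZMod (2 ^ (n + 2))) ^ s.val) *
          ((s.val.choose k : ℕ) : ℚ_[2]) -
        ∑ s : ZMod (2 ^ n),
          msdMinusMeasure f α (n + 2) ((cyclotomicGenerator 2 : ZMod (2 ^ (n + 2))) ^ s.val) *
            ((s.val.choose k : ℕ) : ℚ_[2]) =
      ∑ s : ZMod (2 ^ n), (α⁻¹ ^ (n + 2) * (k₁ s : ℚ_[2]) - α⁻¹ ^ (n + 3) * (k₂ s : ℚ_[2])) *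
          ((s.val.choose k : ℕ) : ℚ_[2]) +
        (α⁻¹ ^ (n + 2) - α⁻¹ ^ (n + 3)) * c *
          ∑ s : ZMod (2 ^ n), ((s.val.choose k : ℕ) : ℚ_[2]) := by
    rw [← Finset.sum_sub_distrib, Finset.mul_sum, ← Finset.sum_add_distrib]
    refine Finset.sum_congr rfl fun s _ ↦ ?_
    rw [← sub_mul, hk s]
    ring
  rw [← mul_sub, hsum, norm_mul, norm_two_two']
  -- hockey stick and Kummer
  have hS : ∑ s : ZMod (2 ^ n), ((s.val.choose k : ℕ) : ℚ_[2]) =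
      (((2 ^ n).choose (k + 1) : ℕ) : ℚ_[2]) := by
    rw [sum_zmod_val_eq_sum_range (2 ^ n) (fun j ↦ ((j.choose k : ℕ) : ℚ_[2])), ← Nat.cast_sum,
      sum_range_choose_eq_choose_succ]
  have hkn : k + 1 < 2 ^ n := lt_of_le_of_lt hn Nat.lt_two_pow_self
  have hSn : ‖∑ s : ZMod (2 ^ n), ((s.val.choose k : ℕ) : ℚ_[2])‖ ≤ 2⁻¹ := by
    rw [hS]; exact norm_choose_two_pow_le_half (Nat.succ_ne_zero k) hkn
  -- the integral part
  have hA : ‖∑ s : ZMod (2 ^ n), (α⁻¹ ^ (n + 2) * (k₁ s : ℚ_[2]) - α⁻¹ ^ (n + 3) * (k₂ s : ℚ_[2])) *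
      ((s.val.choose k : ℕ) : ℚ_[2])‖ ≤ 1 := by
    refine IsUltrametricDist.norm_sum_le_of_forall_le_of_nonneg zero_le_one fun s _ ↦ ?_
    rw [norm_mul]
    have h1 : ‖α⁻¹ ^ (n + 2) * (k₁ s : ℚ_[2]) - α⁻¹ ^ (n + 3) * (k₂ s : ℚ_[2])‖ ≤ 1 := by
      rw [sub_eq_add_neg]
      refine (IsUltrametricDist.norm_add_le_max _ _).trans (max_le ?_ ?_)
      · rw [norm_mul]
        calc _ ≤ 1 * 1 := mul_le_mul (hαi _) (Padic.norm_int_le_one _) (norm_nonneg _) zero_le_one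
          _ = 1 := mul_one _
      · rw [norm_neg, norm_mul]
        calc _ ≤ 1 * 1 := mul_le_mul (hαi _) (Padic.norm_int_le_one _) (norm_nonneg _) zero_le_one
          _ = 1 := mul_one _
    calc _ ≤ 1 * 1 := mul_le_mul h1 (norm_natCast_le_one' _) (norm_nonneg _) zero_le_one
      _ = 1 := mul_one _
  -- the offset part
  have hB : ‖(α⁻¹ ^ (n + 2) - α⁻¹ ^ (n + 3)) * c *
      ∑ s : ZMod (2 ^ n), ((s.val.choose k : ℕ) : ℚ_[2])‖ ≤ 1 := by
    have hαα : α⁻¹ ^ (n + 3) * α = α⁻¹ ^ (n + 2) := by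
      rw [pow_succ, mul_assoc, inv_mul_cancel₀ hα0, mul_one]
    have hre : (α⁻¹ ^ (n + 2) - α⁻¹ ^ (n + 3)) * c = α⁻¹ ^ (n + 3) * ((α - 1) * c) := by
      linear_combination (-c) * hαα
    rw [hre, norm_mul, norm_mul]
    calc ‖α⁻¹ ^ (n + 3)‖ * ‖(α - 1) * c‖ * _ ≤ 1 * 2 * 2⁻¹ := by
          gcongr
          · exact hαi _
    _ = 1 := by norm_num
  have hAB := (IsUltrametricDist.norm_add_le_max _ _).trans (max_le hA hB)
  calc (2 : ℝ)⁻¹ * _ ≤ 2⁻¹ * 1 := by gcongr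
    _ = 2⁻¹ := mul_one _

/-- **`‖[Tᵏ](L₂(f,α,ω⁰) − L₂⁻(f,α,ω¹))‖₂ ≤ 2⁻¹` for every `k`**, granted the distribution relations and
the bound `2` for both measures, the symbol congruence and the offset bound. -/
theorem norm_padicLCoeff_sub_minus_le_half (f : CuspForm (Gamma0 N) 2) {α : ℚ_[2]} (hα0 : α ≠ 0)
    (hα : ‖α⁻¹‖ ≤ 1) (hPM : PlusMinusSymbolCongruenceAtTwo f)
    (hc : ‖(α - 1) * ((ratPlusSymbol f (1 / 2) : ℚ) : ℚ_[2])‖ ≤ 2)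
    (hdistp : ∀ (n : ℕ) (a : ZMod (2 ^ n)),
      ∑ b ∈ Finset.univ.filter (fun b : ZMod (2 ^ (n + 1)) ↦
        ZMod.castHom (pow_dvd_pow 2 n.le_succ) (ZMod (2 ^ n)) b = a), msdMeasure f α (n + 1) b =
        msdMeasure f α n a)
    (hdistm : ∀ (n : ℕ) (a : ZMod (2 ^ n)),
      ∑ b ∈ Finset.univ.filter (fun b : ZMod (2 ^ (n + 1)) ↦
        ZMod.castHom (pow_dvd_pow 2 n.le_succ) (ZMod (2 ^ n)) b = a), msdMinusMeasure f α (n + 1) b =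
        msdMinusMeasure f α n a)
    (hbp : ∀ (m : ℕ) (a : ZMod (2 ^ m)), ‖msdMeasure f α m a‖ ≤ 2)
    (hbm : ∀ (m : ℕ) (a : ZMod (2 ^ m)), ‖msdMinusMeasure f α m a‖ ≤ 2) (k : ℕ) :
    ‖padicLCoeff f α k - padicLMinusBranchCoeff f α 1 k‖ ≤ 2⁻¹ := by
  have hT := (tendsto_padicLRiemannSum_of_norm_le hdistp ⟨2, hbp⟩ k).sub
    (tendsto_padicLMinusBranchRiemannSum f α hdistm hbm 1 k)
  exact le_of_tendsto hT.norm (Filter.eventually_atTop.2 ⟨k + 1, fun n hn ↦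
    norm_riemannSum_sub_minus_le_half f hα0 hα hPM hc hn⟩)

/-- **A♮L, good ordinary odd level (THEOREM).** For a rational newform `f` of ODD level with
RHOMBIC period lattice, `a₂ = a₂(f)`, and a root `α` of `X² − a₂X + 2` with `‖α‖ ≤ 1`, `‖α⁻¹‖ ≤ 1`
(the unit root when `a₂` is odd): the even branch `L₂(f, α, ω⁰, T)` and the odd branch
`L₂⁻(f, α, ω¹, T)` both lie in `Λ₂ = ℤ₂⟦T⟧` and are CONGRUENT mod `2Λ₂`. Inputs: A♮sym
(`rhombicSymbolCongruence_holds`, p544233), INT2-AUTO (`norm_padicLCoeff_two_le_one_auto`), the odd-branch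
integrality (`norm_padicLMinusBranchCoeff_two_le_one`), the distribution relations, and §B above. -/
theorem branchCongruenceModTwo_of_rhombic (f : CuspForm (Gamma0 N) 2) (hf : IsNewform0 f)
    (hQ : coeffField f = ⊥) (h2N : ¬ 2 ∣ N) (hrh : IsRhombic f) {a₂ : ℤ}
    (ha₂ : cuspCoeff f 2 = a₂) {α : ℚ_[2]} (hα : ‖α⁻¹‖ ≤ 1) (hα1 : ‖α‖ ≤ 1)
    (hroot : α ^ 2 - a₂ * α + 2 = 0) : BranchCongruenceModTwo f α := by
  have hα0 : α ≠ 0 := by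
    rintro rfl
    norm_num at hroot
  have hreal := cuspCoeff_im_eq_zero_of_coeffField_eq_bot hQ
  have h4 : ¬ 4 ∣ N := fun h ↦ h2N (dvd_trans ⟨2, by norm_num⟩ h)
  have hPM : PlusMinusSymbolCongruenceAtTwo f := rhombicSymbolCongruence_holds f hf hQ h4 hrh
  have hdistp : ∀ (n : ℕ) (a : ZMod (2 ^ n)),
      ∑ b ∈ Finset.univ.filter (fun b : ZMod (2 ^ (n + 1)) ↦
        ZMod.castHom (pow_dvd_pow 2 n.le_succ) (ZMod (2 ^ n)) b = a), msdMeasure f α (n + 1) b =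
        msdMeasure f α n a := fun n a ↦
    sum_fiber_msdMeasure_succ_eq (p := 2) (ratCast_ratPlusSymbol_holds hf hQ) hf h2N ha₂ hα0 hroot n a
  have hdistm : ∀ (n : ℕ) (a : ZMod (2 ^ n)),
      ∑ b ∈ Finset.univ.filter (fun b : ZMod (2 ^ (n + 1)) ↦
        ZMod.castHom (pow_dvd_pow 2 n.le_succ) (ZMod (2 ^ n)) b = a), msdMinusMeasure f α (n + 1) b =
        msdMinusMeasure f α n a :=
    sum_fiber_msdMinusMeasure_succ_eq_of_coeffField (p := 2) hf hQ h2N ha₂ hα0 hroot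
  have hbp := norm_msdMeasure_two_le_two_auto (f := f) hf hreal h2N ha₂ hα hroot
  have hbm := norm_msdMinusMeasure_two_le_two f hreal h4 hα
  -- the offset bound `‖(α − 1)[1/2]⁺‖ ≤ 2` from `‖(α − 1)[0]⁺‖ ≤ 2` and `[1/2]⁺ = [0]⁺ + z/2`
  have hc : ‖(α - 1) * ((ratPlusSymbol f (1 / 2) : ℚ) : ℚ_[2])‖ ≤ 2 := by
    obtain ⟨z, hz⟩ :=
      exists_ratPlusSymbol_eq_add_div_two f hreal (coprime_den_div_prime_pow (p := 2) h2N 1 1)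
    have e : (((1 : ℕ) : ℚ) / ((2 : ℕ) : ℚ) ^ 1) = 1 / 2 := by norm_num
    rw [e] at hz
    have h0 := norm_sub_one_mul_ratPlusSymbol_zero_le_two hf hreal h2N ha₂ hα hroot
    rw [hz]
    push_cast
    rw [mul_add]
    refine (IsUltrametricDist.norm_add_le_max _ _).trans (max_le h0 ?_)
    have hα1' : ‖α - 1‖ ≤ 1 := by
      rw [sub_eq_add_neg]
      refine (IsUltrametricDist.norm_add_le_max _ _).trans (max_le hα1 ?_)
      rw [norm_neg, norm_one]
    have hz2 : ‖((z : ℚ_[2])) / 2‖ ≤ 2 := by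
      rw [norm_div, norm_two_two', div_le_iff₀ (by norm_num)]
      calc ‖(z : ℚ_[2])‖ ≤ 1 := Padic.norm_int_le_one _
        _ = 2 * 2⁻¹ := by norm_num
    rw [norm_mul]
    calc ‖α - 1‖ * _ ≤ 1 * 2 := mul_le_mul hα1' hz2 (norm_nonneg _) zero_le_one
      _ = 2 := one_mul _
  have hkey := norm_padicLCoeff_sub_minus_le_half f hα0 hα hPM hc hdistp hdistm hbp hbm
  -- both branches are integral
  obtain ⟨G, hG⟩ : ∃ G : IwasawaAlgebra 2, iwasawaToPowerSeries 2 G = padicLFunction f α :=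
    (exists_iwasawaToPowerSeries_eq_iff_norm_coeff_le_one _).mpr fun k ↦ by
      rw [coeff_padicLFunction]
      exact norm_padicLCoeff_two_le_one_auto hf hreal h2N ha₂ hα hroot hdistp k
  obtain ⟨D, hD⟩ : ∃ D : IwasawaAlgebra 2,
      iwasawaToPowerSeries 2 D = padicLFunctionMinusBranch f α 1 :=
    (exists_iwasawaToPowerSeries_eq_iff_norm_coeff_le_one _).mpr fun k ↦ by
      rw [coeff_padicLFunctionMinusBranch]
      exact norm_padicLMinusBranchCoeff_two_le_one f α hdistm hreal h4 hα odd_one k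
  -- the half-difference is integral
  set L' : PowerSeries ℚ_[2] :=
    PowerSeries.mk fun k ↦ (padicLCoeff f α k - padicLMinusBranchCoeff f α 1 k) / 2 with hL'
  obtain ⟨H, hH⟩ : ∃ H : IwasawaAlgebra 2, iwasawaToPowerSeries 2 H = L' :=
    (exists_iwasawaToPowerSeries_eq_iff_norm_coeff_le_one _).mpr fun k ↦ by
      rw [hL', PowerSeries.coeff_mk, norm_div, norm_two_two', div_le_iff₀ (by norm_num), one_mul]
      exact hkey k
  refine ⟨G, D, hG, hD, H, ?_⟩
  apply iwasawaToPowerSeries_injective 2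
  have hC2 : iwasawaToPowerSeries 2 (PowerSeries.C (2 : ℤ_[2])) = PowerSeries.C (2 : ℚ_[2]) := by
    show PowerSeries.map (algebraMap ℤ_[2] ℚ_[2]) (PowerSeries.C (2 : ℤ_[2])) = _
    rw [PowerSeries.map_C, map_ofNat]
  rw [map_sub, map_mul, hG, hD, hH, hC2]
  ext k
  rw [map_sub, coeff_padicLFunction, coeff_padicLFunctionMinusBranch, PowerSeries.coeff_C_mul, hL',
    PowerSeries.coeff_mk]
  ring

/-- **A♮L, good-ordinary clause of `RhombicBranchCongruence` (THEOREM).** -/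
theorem rhombicBranchCongruence_goodOrdinary ⦃N : ℕ⦄ [NeZero N] (f : CuspForm (Gamma0 N) 2)
    (a₂ : ℤ) (hf : IsNewform0 f) (hQ : coeffField f = ⊥) (hrh : IsRhombic f)
    (ha₂ : cuspCoeff f 2 = (a₂ : ℂ)) (h2N : ¬ 2 ∣ N) (α : ℤ_[2]) (hu : IsUnit α)
    (hroot : (α : ℚ_[2]) ^ 2 - (a₂ : ℚ_[2]) * α + 2 = 0) :
    BranchCongruenceModTwo f (α : ℚ_[2]) := by
  have h1 : ‖(α : ℚ_[2])‖ = 1 := by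
    rw [← PadicInt.norm_def]; exact PadicInt.isUnit_iff.mp hu
  have hα : ‖(α : ℚ_[2])⁻¹‖ ≤ 1 := by rw [norm_inv, h1, inv_one]
  exact branchCongruenceModTwo_of_rhombic f hf hQ h2N hrh ha₂ hα h1.le hroot

/-- **Curve level: `RhombicOfNegDisc → OrdinaryBranchCongruenceAtTwo` (THEOREM modulo the
period-lattice shape fact).** For `E = W/ℚ` globally minimal, good ordinary at `2`, with rhombic
`Λ_f` (which `RhombicOfNegDisc` asserts for `Δ < 0`, `E(ℚ)[2] = 0`): `L₂(E,ω⁰) ≡ L₂⁻(E,ω¹) (mod 2Λ₂)`. -/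
theorem ordinaryBranchCongruenceAtTwo_of_rhombicOfNegDisc (hR : RhombicOfNegDisc) :
    OrdinaryBranchCongruenceAtTwo := by
  intro W _ _ hord hΔ htor N _ f hf
  obtain ⟨hαeq, hαu, -⟩ := unitRoot_coe_spec (W := W) hord
  have hpN : ¬ 2 ∣ N := not_dvd_level_of_isNewformOf hf hord.1
  have hap : cuspCoeff f 2 = ((W.frobeniusTrace 2 : ℤ) : ℂ) :=
    cuspCoeff_eq_frobeniusTrace_of_isNewformOf_holds hf hord.1
  have hα : ‖(unitRoot W 2 : ℚ_[2])⁻¹‖ ≤ 1 := by rw [norm_inv, hαu, inv_one]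
  exact branchCongruenceModTwo_of_rhombic f hf.1 hf.coeffField_eq_bot hpN (hR W hΔ htor f hf) hap hα
    hαu.le hαeq

/-- **Tree conjecture A from K2μ and the lattice-shape fact alone (THEOREM):**
`RhombicOfNegDisc → AnalyticMuZeroAtTwo → OddEvenCongruenceAtTwo`. -/
theorem oddEvenCongruenceAtTwo_of_rhombicOfNegDisc_of_muZero (hR : RhombicOfNegDisc)
    (hμ : AnalyticMuZeroAtTwo) : OddEvenCongruenceAtTwo :=
  oddEvenCongruence_of_modTwo_of_muZero (ordinaryBranchCongruenceAtTwo_of_rhombicOfNegDisc hR) hμ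

/-- **Tree crux K3 from the same two inputs (THEOREM).** -/
theorem oddBranchCertificateSupply_of_rhombicOfNegDisc_of_muZero (hR : RhombicOfNegDisc)
    (hμ : AnalyticMuZeroAtTwo) : OddBranchCertificateSupply :=
  oddBranchCertificateSupply_of_modTwo_of_muZero
    (ordinaryBranchCongruenceAtTwo_of_rhombicOfNegDisc hR) hμ

end BranchAlgebra

/-- `RhombicOfNegDisc → SupersingularLayerCongruenceAtTwo` (tree glue + A♮sym `rhombicSymbolCongruence_holds`). -/
theorem supersingularLayerCongruenceAtTwo_of_rhombicOfNegDisc (hR : RhombicOfNegDisc) :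
    SupersingularLayerCongruenceAtTwo :=
  supersingularLayerCongruence_of_rhombic rhombicSymbolCongruence_holds hR

end Summit.BirchSwinnertonDyer.Rank1Residual.F1Sign2
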